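import Mathlib
import Literature.LinearAlgebra.Matrix.FactorWidthTwo

/-!
# Congruence–Gershgorin: a certified LOWER eigenvalue bound for a symmetric matrix from the row
# margins of a float congruence (instab3 g2, cell `ns-blowup`, 2026-08-26)

HONEST FRAMING (human ruling D-0035): nothing here is a claim about Navier–Stokes blow-up.
WHAT THIS IS NOT: not NS evidence. Kernel form of the positivity test used by implementation 1's
skew-cut certifier (`HOME/instab3/code/i3cert.py`, INSTAB3-METHOD §5 step (V5), the SHARP verdict
«`MU2_K > 0`» of the X0(800)/X0(1000) certificates kit j250421/j250422, and the `λ_min(sym P̂) > t` /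
`λ_max ≤ σ` tests of the relaxed route, `SkewCutRelaxedEnclosure.lean`) and by the cap D2 recursion
(«Gershgorin after a float congruence», `APosterioriInverseBound.lean` docstring):

to certify `λ_min(X) > μ` for an exactly known symmetric `X` (a ball matrix), take the FLOAT
eigenvector matrix `V` of the midpoint of `X`, form `B := Vᵀ (X − μ·1) V` in ball arithmetic, and
check that every row has a positive margin `B_ii − Σ_{j≠i} |B_ij| ≥ ε > 0`. Then `B − ε·1` is
diagonally dominant, hence positive semidefinite (`Literature…IsDiagDominant.posSemidef`,
Boman–Chen–Parekh–Toledo / Ahmadi–Majumdar), so `B ≻ 0`; a positive definite congruence `Vᵀ Y V`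
forces `V` to be nonsingular, and then `Y = V⁻ᵀ B V⁻¹ ≻ 0`. No property of `V` is assumed — a bad
`V` can only make the test fail.

* `posDef_of_rowMargin` — symmetric + row margins `≥ ε > 0` ⇒ `A ≻ 0` and `vᵀAv ≥ ε vᵀv`.
* `isUnit_det_of_congr_posDef`, `posDef_of_congr_posDef` — `Vᵀ Y V ≻ 0`, `Y` symmetric, `V` square
  ⇒ `V` nonsingular and `Y ≻ 0`.
* `posDef_sub_smul_of_congr_rowMargin` — the assembled test: row margins of `Vᵀ(X − μ·1)V` `≥ ε > 0`
  ⇒ `X − μ·1 ≻ 0`, i.e. `μ·wᵀw < wᵀXw` for every `w ≠ 0` (`λ_min(X) > μ`); the UPPER-bound form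
  (`λ_max(X) < σ` from the margins of `Vᵀ(σ·1 − X)V`) is the same statement for `−X`.

Mathlib + one Literature file; no new definitions. MODEL lane; bears_on LADDER-NS N1* (⟦I-X0⟧
certificate rigour); METER 0.
-/

namespace Summit.NavierStokesRegularity.FluidComputer.CongruenceDominancePosDef

open Matrix Finset
open Literature.LinearAlgebra.Matrix (IsDiagDominant)

variable {n : Type*} [Fintype n] [DecidableEq n]

omit [Fintype n] in
/-- A shifted symmetric matrix is symmetric. -/
theorem isSymm_sub_smul_one {A : Matrix n n ℝ} (hA : A.IsSymm) (c : ℝ) :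
    (A - c • (1 : Matrix n n ℝ)).IsSymm := by
  unfold Matrix.IsSymm at hA ⊢
  rw [transpose_sub, transpose_smul, transpose_one, hA]

/-- **Strict diagonal dominance with a margin ⇒ positive definite, quantitatively.** If `A` is
symmetric and every row satisfies `Σ_{j ≠ i} |a_ij| + ε ≤ a_ii` with `ε > 0`, then `A ≻ 0` and
`vᵀ A v ≥ ε·vᵀv` for all `v` (`A − ε·1` is diagonally dominant, hence PSD). This is what a ball
evaluation of the row margins certifies. -/
theorem posDef_of_rowMargin {A : Matrix n n ℝ} (hA : A.IsSymm) {ε : ℝ} (hε : 0 < ε)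
    (h : ∀ i, ∑ j ∈ univ.erase i, |A i j| + ε ≤ A i i) :
    A.PosDef ∧ ∀ v : n → ℝ, ε * (v ⬝ᵥ v) ≤ v ⬝ᵥ (A *ᵥ v) := by
  have hdd : IsDiagDominant (A - ε • (1 : Matrix n n ℝ)) := by
    intro i
    have hdiag : (A - ε • (1 : Matrix n n ℝ)) i i = A i i - ε := by simp
    have hoff : ∀ j ∈ univ.erase i, |(A - ε • (1 : Matrix n n ℝ)) i j| = |A i j| := by
      intro j hj
      have hne : i ≠ j := fun hij => (mem_erase.mp hj).1 hij.symm
      simp [hne]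
    rw [hdiag, sum_congr rfl hoff]
    linarith [h i]
  have hpsd : (A - ε • (1 : Matrix n n ℝ)).PosSemidef :=
    IsDiagDominant.posSemidef (isSymm_sub_smul_one hA ε) hdd
  have key : ∀ v : n → ℝ, ε * (v ⬝ᵥ v) ≤ v ⬝ᵥ (A *ᵥ v) := by
    intro v
    have h0 := hpsd.dotProduct_mulVec_nonneg v
    simp only [star_trivial] at h0
    rw [sub_mulVec, dotProduct_sub, smul_mulVec, one_mulVec, dotProduct_smul, smul_eq_mul] at h0
    linarith
  have hherm : A.IsHermitian := by
    rw [Matrix.IsHermitian, conjTranspose_eq_transpose_of_trivial]; exact hA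
  refine ⟨PosDef.of_dotProduct_mulVec_pos hherm fun v hv => ?_, key⟩
  have hvv : 0 < v ⬝ᵥ v := by
    rcases lt_or_eq_of_le (dotProduct_star_self_nonneg v) with h1 | h1
    · simpa using h1
    · exact absurd (dotProduct_self_eq_zero.mp (by simpa using h1.symm)) hv
  simp only [star_trivial]
  nlinarith [key v]

/-- **A positive definite congruence has a nonsingular congruence matrix.** If `Vᵀ Y V ≻ 0` for
square `V` then `det V ≠ 0` (`det (VᵀYV) = det V · det Y · det V ≠ 0`). -/
theorem isUnit_det_of_congr_posDef {Y V : Matrix n n ℝ} (h : (Vᵀ * Y * V).PosDef) :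
    IsUnit V.det := by
  have hB : IsUnit (Vᵀ * Y * V).det := (Matrix.isUnit_iff_isUnit_det _).mp h.isUnit
  rw [det_mul, det_mul, det_transpose] at hB
  exact isUnit_of_mul_isUnit_right hB

/-- **Positive definiteness transfers back through a square congruence.** If `Y` is symmetric and
`Vᵀ Y V ≻ 0` for a SQUARE `V` (no other property of `V` assumed), then `Y ≻ 0`: `V` is
nonsingular by `isUnit_det_of_congr_posDef`, and `wᵀ Y w = uᵀ (Vᵀ Y V) u > 0` with `u = V⁻¹ w`. -/
theorem posDef_of_congr_posDef {Y V : Matrix n n ℝ} (hY : Y.IsSymm) (h : (Vᵀ * Y * V).PosDef) :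
    Y.PosDef := by
  have hV : IsUnit V.det := isUnit_det_of_congr_posDef h
  have hherm : Y.IsHermitian := by
    rw [Matrix.IsHermitian, conjTranspose_eq_transpose_of_trivial]; exact hY
  refine PosDef.of_dotProduct_mulVec_pos hherm fun w hw => ?_
  set u : n → ℝ := V⁻¹ *ᵥ w with hu
  have hwu : V *ᵥ u = w := by rw [hu, mulVec_mulVec, mul_nonsing_inv _ hV, one_mulVec]
  have hu0 : u ≠ 0 := by
    intro h0; apply hw; rw [← hwu, h0, mulVec_zero]
  have hpos := h.dotProduct_mulVec_pos hu0
  simp only [star_trivial] at hpos ⊢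
  rwa [← mulVec_mulVec, ← mulVec_mulVec, dotProduct_mulVec, vecMul_transpose, hwu] at hpos

/-- **The congruence–Gershgorin test (i3cert (V5); cap D2 «Gershgorin after a float congruence»).**
`X` symmetric (exact), `V` ANY square matrix (in practice the float eigenvectors of the midpoint of
`X`), `μ` real. If every row of `B := Vᵀ (X − μ·1) V` has margin `B_ii − Σ_{j≠i} |B_ij| ≥ ε > 0`,
then `X − μ·1 ≻ 0`; in particular `μ·wᵀw < wᵀ X w` for all `w ≠ 0`, i.e. `λ_min(X) > μ`. Applied
with `X = Λ_{K+1} − √2·1 + Q_K` (sharp form (I*), `μ = μ̲`), with `X = P̂ + P̂ᵀ` (relaxed `τ`), and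
to `σ·1 − Wᵀ S̲⁻¹ W` (relaxed `σ`, the same test on the negated matrix). -/
theorem posDef_sub_smul_of_congr_rowMargin (X V : Matrix n n ℝ) (hX : X.IsSymm) (μ : ℝ) {ε : ℝ}
    (hε : 0 < ε)
    (h : ∀ i, ∑ j ∈ univ.erase i, |(Vᵀ * (X - μ • (1 : Matrix n n ℝ)) * V) i j| + ε ≤
      (Vᵀ * (X - μ • (1 : Matrix n n ℝ)) * V) i i) :
    (X - μ • (1 : Matrix n n ℝ)).PosDef ∧
      ∀ w : n → ℝ, w ≠ 0 → μ * (w ⬝ᵥ w) < w ⬝ᵥ (X *ᵥ w) := by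
  have hXs : (X - μ • (1 : Matrix n n ℝ)).IsSymm := isSymm_sub_smul_one hX μ
  have hBs : (Vᵀ * (X - μ • (1 : Matrix n n ℝ)) * V).IsSymm := by
    unfold Matrix.IsSymm at hXs ⊢
    rw [transpose_mul, transpose_mul, transpose_transpose, hXs, Matrix.mul_assoc]
  have hB := (posDef_of_rowMargin hBs hε h).1
  have hP : (X - μ • (1 : Matrix n n ℝ)).PosDef := posDef_of_congr_posDef hXs hB
  refine ⟨hP, fun w hw => ?_⟩
  have hpos := hP.dotProduct_mulVec_pos hw
  simp only [star_trivial] at hpos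
  rw [sub_mulVec, dotProduct_sub, smul_mulVec, one_mulVec, dotProduct_smul, smul_eq_mul] at hpos
  linarith

end Summit.NavierStokesRegularity.FluidComputer.CongruenceDominancePosDef
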